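import Summits.KontsevichZagierPeriods.KontsevichZagierPeriods.Theorems.TerasomaMultiplicationBetaCancellationStubFibreSubstitutionAE

/-!
# `BetaCancellation` (stmt-KontsevichZagierPeriods-13633), line `dirichlet-companion-to-pi` — stub `stub_fibreSubstitutionTwoCatalystsAE`

**The measure-theoretic core of the catalyst-exchange sector (two catalysts).** Let `p₁`, `p₂` be
representations of the same dimension `d` with `p₁.value ≠ 0`, `p₂.value ≠ 0`, and let `c : ℝ` satisfy
`c · p₂.value = p₁.value`. Let `q = p₁ ⊗ r` and `q' = p₂ ⊗ r'` be the pinned products in the crux's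
coordinates (catalyst first, `Fin.castAdd n i`; factor last, `Fin.natAdd d j`), and let `Φ` be ONE
change of variables from `q.domain` onto `q'.domain` (the hypotheses of `KZ.changeOfVariablesRel`:
derivative `Φ'` within the domain, injective, image the target domain,
`q.integrand z = q'.integrand (Φ z) · |det Φ' z|`) which is of FIBRE FORM over a substitution `ψ` of
the factor coordinates, `tail (Φ z) = ψ (tail z)`, with `ψ` injective on `σ = r.domain` and
differentiable within `σ`. Then the factor integrands satisfy the scaled rule-(2) identity
`c · f = (f' ∘ ψ) · |det ψ'|` ALMOST EVERYWHERE on `σ` (`f = r.integrand`, `f' = r'.integrand`).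
The one-catalyst case `p₁ = p₂`, `c = 1` is `stub_fibreSubstitutionAE` (module
`…StubFibreSubstitutionAE`, whose cylinder helpers `fibreAE_mem_image_prod`,
`fibreAE_measurableSet_image_prod`, `fibreAE_setIntegral_image_prod_mul` are reused here).

Proof. `K₁ = p₁.domain` is non-empty (else `p₁.value = 0`), whence `ψ` maps `σ` into
`σ' = r'.domain` (push a point `(x₀, w)` of `q.domain` through `Φ`). For a measurable `A ⊆ σ` the
cylinder `S_A = K₁ × A ⊆ q.domain` is measurable and `Φ '' S_A = K₂ × ψ(A)` (`K₂ = p₂.domain`; fibre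
form, and injectivity of `ψ` on `σ` for `⊇`). The change-of-variables formula for `Φ` on `S_A`
(`MeasureTheory.integral_image_eq_integral_abs_det_fderiv_smul`) and the Jacobian identity give
`∫_{K₂ × ψ(A)} q' = ∫_{S_A} q`; Fubini (`KZ.appendMeasurableEquiv`,
`MeasureTheory.setIntegral_prod_mul`) evaluates the two sides as `p₂.value · ∫_{ψ(A)} f'` and
`p₁.value · ∫_A f` (`ψ(A)` is measurable by Lusin–Souslin,
`MeasurableSet.image_of_continuousOn_injOn`); the change of variables for `ψ` on `A` turns the
first into `p₂.value · ∫_A |det ψ'| · (f' ∘ ψ)`. Writing `p₁.value = c · p₂.value` and moving `c`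
inside the integral (`MeasureTheory.integral_const_mul`), `p₂.value ≠ 0` cancels:
`∫_A c · f = ∫_A |det ψ'| · (f' ∘ ψ)`. Since `|det ψ'| · (f' ∘ ψ)` is integrable on `σ`
(`MeasureTheory.integrableOn_image_iff_integrableOn_abs_det_fderiv_smul`, `ψ(σ) ⊆ σ'`), equality of
the integrals over every measurable `A ⊆ σ` gives equality a.e.
(`MeasureTheory.Integrable.ae_eq_of_forall_setIntegral_eq`). No semialgebraic geometry is used
beyond measurability of the domains. No definitions; sorry-free;
axioms ⊆ {propext, Classical.choice, Quot.sound}.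

References: M. Kontsevich, D. Zagier, *Periods* (2001), §1.2 rule (2), §4.1 ("Fubini formula").
-/

noncomputable section

-- `Summit.KontsevichZagierPeriods.KontsevichZagierPeriods.…` is the tree's mandated layout (single-conjunct summit).
set_option linter.dupNamespace false

namespace Summit.KontsevichZagierPeriods.KontsevichZagierPeriods.BetaCancellationLine

open MeasureTheory Set
open Literature.NumberTheory.Transcendental
open Literature.NumberTheory.Transcendental.KZ

/-- STUB (measure core with two catalysts, seat c14 cycle 4). As `stub_fibreSubstitutionAE`, with the
source product pinned over the catalyst `p₁` and the target over `p₂` (both of non-zero value, same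
dimension) and a real `c` with `c · p₂.value = p₁.value`: for ONE change of variables `Φ` from
`q = p₁ ⊗ r` onto `q' = p₂ ⊗ r'` of FIBRE FORM over an injective `ψ` on `r.domain`
(`tail (Φ z) = ψ (tail z)`), the factor integrands satisfy `c · f = (f' ∘ ψ) · |det ψ'|` ALMOST
EVERYWHERE on `r.domain`: test the change-of-variables formula for `Φ` on the cylinders `K₁ × A`
(`A ⊆ r.domain` measurable; their images are `K₂ × ψ(A)` by injectivity of `ψ`), evaluate both sides
by Fubini (`KZ.appendMeasurableEquiv`, `setIntegral_prod_mul`) as `p₁.value · ∫_A f` and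
`p₂.value · ∫_{ψ A} f' = p₂.value · ∫_A (f' ∘ ψ)|det ψ'|` (change of variables for `ψ` on `A`),
substitute `p₁.value = c · p₂.value`, cancel `p₂.value ≠ 0`, and conclude by
`Integrable.ae_eq_of_forall_setIntegral_eq`. [cite: KontsevichZagier2001, §1.2 rule (2)] -/
theorem stub_fibreSubstitutionTwoCatalystsAE {d n : ℕ} (p₁ p₂ : IntegralRep d) (hp₁ : p₁.value ≠ 0)
    (hp₂ : p₂.value ≠ 0) (c : ℝ) (hcv : c * p₂.value = p₁.value)
    (r r' : IntegralRep n) (q q' : IntegralRep (d + n))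
    (hq : q.domain = {z | (fun i => z (Fin.castAdd n i)) ∈ p₁.domain ∧
      (fun j => z (Fin.natAdd d j)) ∈ r.domain})
    (hqi : Set.EqOn q.integrand (fun z => p₁.integrand (fun i => z (Fin.castAdd n i)) *
      r.integrand (fun j => z (Fin.natAdd d j))) q.domain)
    (hq' : q'.domain = {z | (fun i => z (Fin.castAdd n i)) ∈ p₂.domain ∧
      (fun j => z (Fin.natAdd d j)) ∈ r'.domain})
    (hq'i : Set.EqOn q'.integrand (fun z => p₂.integrand (fun i => z (Fin.castAdd n i)) *
      r'.integrand (fun j => z (Fin.natAdd d j))) q'.domain)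
    (Φ : (Fin (d + n) → ℝ) → (Fin (d + n) → ℝ))
    (Φ' : (Fin (d + n) → ℝ) → (Fin (d + n) → ℝ) →L[ℝ] (Fin (d + n) → ℝ))
    (hΦ' : ∀ z ∈ q.domain, HasFDerivWithinAt Φ (Φ' z) q.domain z) (hΦinj : Set.InjOn Φ q.domain)
    (himg : q'.domain = Φ '' q.domain)
    (hjac : ∀ z ∈ q.domain, q.integrand z = q'.integrand (Φ z) * |(Φ' z).det|)
    (ψ : (Fin n → ℝ) → (Fin n → ℝ)) (ψ' : (Fin n → ℝ) → (Fin n → ℝ) →L[ℝ] (Fin n → ℝ))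
    (hfib : ∀ z ∈ q.domain, (fun j => Φ z (Fin.natAdd d j)) = ψ (fun j => z (Fin.natAdd d j)))
    (hψ' : ∀ w ∈ r.domain, HasFDerivWithinAt ψ (ψ' w) r.domain w) (hψinj : Set.InjOn ψ r.domain) :
    ∀ᵐ w ∂(MeasureTheory.volume.restrict r.domain),
      c * r.integrand w = r'.integrand (ψ w) * |(ψ' w).det| := by
  have hK₁m : MeasurableSet p₁.domain := IntegralRep.measurableSet_domain_holds p₁
  have hK₂m : MeasurableSet p₂.domain := IntegralRep.measurableSet_domain_holds p₂
  have hσm : MeasurableSet r.domain := IntegralRep.measurableSet_domain_holds r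
  -- the source catalyst domain is non-empty, since `p₁.value ≠ 0`
  have hKne : p₁.domain.Nonempty := by
    by_contra h
    apply hp₁
    rw [not_nonempty_iff_eq_empty] at h
    simp [IntegralRep.value, h]
  obtain ⟨x₀, hx₀⟩ := hKne
  -- membership in the two pinned product domains
  have hmemq : ∀ z, z ∈ q.domain ↔ (fun i => z (Fin.castAdd n i)) ∈ p₁.domain ∧
      (fun j => z (Fin.natAdd d j)) ∈ r.domain := fun z => by rw [hq]; rfl
  have hmemq' : ∀ z, z ∈ q'.domain ↔ (fun i => z (Fin.castAdd n i)) ∈ p₂.domain ∧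
      (fun j => z (Fin.natAdd d j)) ∈ r'.domain := fun z => by rw [hq']; rfl
  -- `ψ` maps `σ` into `σ'`: push `(x₀, w)` through `Φ`
  have hψσ : MapsTo ψ r.domain r'.domain := by
    intro w hw
    have hz : Fin.append x₀ w ∈ q.domain := by
      rw [hmemq]
      simpa using And.intro hx₀ hw
    have hz' : Φ (Fin.append x₀ w) ∈ q'.domain := himg ▸ mem_image_of_mem Φ hz
    rw [hmemq', hfib _ hz] at hz'
    simpa using hz'.2
  -- `ψ` is continuous on `σ`
  have hψc : ContinuousOn ψ r.domain := fun w hw => (hψ' w hw).continuousWithinAt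
  -- the identity of integrals over every measurable `A ⊆ σ`
  have key : ∀ A : Set (Fin n → ℝ), MeasurableSet A → A ⊆ r.domain →
      ∫ w in A, c * r.integrand w = ∫ w in A, |(ψ' w).det| • r'.integrand (ψ w) := by
    intro A hAm hAσ
    -- the cylinder `S = K₁ × A ⊆ q.domain`
    have hSm : MeasurableSet (appendMeasurableEquiv d n '' (p₁.domain ×ˢ A)) :=
      fibreAE_measurableSet_image_prod hK₁m hAm
    have hSq : appendMeasurableEquiv d n '' (p₁.domain ×ˢ A) ⊆ q.domain := by
      intro z hz
      rw [fibreAE_mem_image_prod] at hz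
      rw [hmemq]
      exact ⟨hz.1, hAσ hz.2⟩
    -- the cylinder `S' = K₂ × ψ(A) ⊆ q'.domain`
    have hψAm : MeasurableSet (ψ '' A) :=
      hAm.image_of_continuousOn_injOn (hψc.mono hAσ) (hψinj.mono hAσ)
    have hψA : ψ '' A ⊆ r'.domain := (image_mono hAσ).trans hψσ.image_subset
    have hS'm : MeasurableSet (appendMeasurableEquiv d n '' (p₂.domain ×ˢ (ψ '' A))) :=
      fibreAE_measurableSet_image_prod hK₂m hψAm
    have hS'q : appendMeasurableEquiv d n '' (p₂.domain ×ˢ (ψ '' A)) ⊆ q'.domain := by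
      intro z hz
      rw [fibreAE_mem_image_prod] at hz
      rw [hmemq']
      exact ⟨hz.1, hψA hz.2⟩
    -- `Φ '' S = S'`
    have himS : Φ '' (appendMeasurableEquiv d n '' (p₁.domain ×ˢ A)) =
        appendMeasurableEquiv d n '' (p₂.domain ×ˢ (ψ '' A)) := by
      apply Subset.antisymm
      · rintro _ ⟨z, hz, rfl⟩
        have hzq : z ∈ q.domain := hSq hz
        rw [fibreAE_mem_image_prod] at hz ⊢
        have hΦz : Φ z ∈ q'.domain := himg ▸ mem_image_of_mem Φ hzq
        rw [hmemq'] at hΦz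
        refine ⟨hΦz.1, ?_⟩
        rw [hfib z hzq]
        exact mem_image_of_mem ψ hz.2
      · intro z' hz'
        have hz'q : z' ∈ q'.domain := hS'q hz'
        rw [himg] at hz'q
        obtain ⟨z, hzq, rfl⟩ := hz'q
        refine mem_image_of_mem Φ ?_
        rw [fibreAE_mem_image_prod] at hz' ⊢
        obtain ⟨a, haA, ha⟩ := hz'.2
        rw [hfib z hzq] at ha
        have hz2 := ((hmemq z).1 hzq)
        have haz : a = fun j => z (Fin.natAdd d j) := hψinj (hAσ haA) hz2.2 ha
        exact ⟨hz2.1, haz ▸ haA⟩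
    -- Fubini on `S` (source product, catalyst `p₁`)
    have h1 : ∫ z in appendMeasurableEquiv d n '' (p₁.domain ×ˢ A), q.integrand z =
        p₁.value * ∫ w in A, r.integrand w := by
      rw [setIntegral_congr_fun hSm (hqi.mono hSq)]
      exact fibreAE_setIntegral_image_prod_mul _ _ _ _
    -- Fubini on `S'` (target product, catalyst `p₂`)
    have h2 : ∫ z in appendMeasurableEquiv d n '' (p₂.domain ×ˢ (ψ '' A)), q'.integrand z =
        p₂.value * ∫ w in ψ '' A, r'.integrand w := by
      rw [setIntegral_congr_fun hS'm (hq'i.mono hS'q)]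
      exact fibreAE_setIntegral_image_prod_mul _ _ _ _
    -- change of variables for `Φ` on `S`
    have h3 : ∫ z in appendMeasurableEquiv d n '' (p₂.domain ×ˢ (ψ '' A)), q'.integrand z =
        ∫ z in appendMeasurableEquiv d n '' (p₁.domain ×ˢ A), q.integrand z := by
      rw [← himS, integral_image_eq_integral_abs_det_fderiv_smul volume hSm
        (fun z hz => (hΦ' z (hSq hz)).mono hSq) (hΦinj.mono hSq)]
      refine setIntegral_congr_fun hSm fun z hz => ?_
      simp only [smul_eq_mul]
      rw [hjac z (hSq hz), mul_comm]
    -- change of variables for `ψ` on `A`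
    have h4 : ∫ w in ψ '' A, r'.integrand w = ∫ w in A, |(ψ' w).det| • r'.integrand (ψ w) :=
      integral_image_eq_integral_abs_det_fderiv_smul volume hAm
        (fun w hw => (hψ' w (hAσ hw)).mono hAσ) (hψinj.mono hAσ) _
    -- assemble: `p₁.value · ∫_A f = p₂.value · ∫_A |det ψ'| • (f' ∘ ψ)`
    have h5 : p₁.value * ∫ w in A, r.integrand w =
        p₂.value * ∫ w in A, |(ψ' w).det| • r'.integrand (ψ w) := by
      rw [← h1, ← h3, h2, h4]
    -- move `c` out of the integral, substitute `p₁.value = c · p₂.value`, cancel `p₂.value ≠ 0`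
    rw [integral_const_mul]
    refine mul_left_cancel₀ hp₂ ?_
    calc p₂.value * (c * ∫ w in A, r.integrand w)
        = (c * p₂.value) * ∫ w in A, r.integrand w := by ring
      _ = p₂.value * ∫ w in A, |(ψ' w).det| • r'.integrand (ψ w) := by rw [hcv, h5]
  -- integrability of the right-hand side on `σ`
  have hg : IntegrableOn (fun w => |(ψ' w).det| • r'.integrand (ψ w)) r.domain :=
    (integrableOn_image_iff_integrableOn_abs_det_fderiv_smul volume hσm hψ' hψinj
      r'.integrand).mp (r'.integrableOn.mono_set hψσ.image_subset)
  have hae : (fun w => c * r.integrand w) =ᵐ[volume.restrict r.domain]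
      fun w => |(ψ' w).det| • r'.integrand (ψ w) := by
    refine Integrable.ae_eq_of_forall_setIntegral_eq _ _
      (r.integrableOn.integrable.const_mul c) hg.integrable fun s hs _ => ?_
    rw [Measure.restrict_restrict hs]
    exact key (s ∩ r.domain) (hs.inter hσm) inter_subset_right
  filter_upwards [hae] with w hw
  rw [hw, smul_eq_mul, mul_comm]

end Summit.KontsevichZagierPeriods.KontsevichZagierPeriods.BetaCancellationLine

end
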